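import Summits.Ventures.YMGap.Thresholds.OneLinkPsiTwoGradientL2
import Summits.Ventures.YMGap.Thresholds.OneLinkRemainderIdentity
import HarnessLib

/-!
# Venture YMGap — the one-link modulus beyond first order, part 21: Minkowski for the `Γ`-seminorm and the `L²(ν_B)` gradient
# norm of `u + ψ₂` through `√((1+ω)/2)`

HONEST FRAMING: venture file of the cell `pub-ymgap` (QuantumFields programme), strong-coupling LATTICE bookkeeping for `SU(N)`
lattice Yang–Mills; nothing about the continuum or the mass gap in the Clay sense.  No number of record (cell note
`HOME/p2/ONE-LINK-HIERARCHY.md` §4 (4.5), the `√(½ + ½ω)` entry).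

WHAT.
* `sqrt_integral_Gam_add_le`: `√∫Γ(f+g,f+g) dν ≤ √∫Γ(f,f) dν + √∫Γ(g,g) dν` for smooth `f, g` and any finite measure on `SU(N)`;
* `integral_Gam_pot_one_le`: `∫Γ(u,u) dν_B ≤ ½‖Δ‖_F² + ½|E Re tr(gΔgΔ)|` (`u = Re tr(·Δ)`);
* `sqrt_integral_Gam_upsi_le_omega`: if `|E Re tr(gΔgΔ)| ≤ ω‖Δ‖_F²` then
  `√∫Γ(u+ψ₂,u+ψ₂) dν_B ≤ ‖Δ‖_F √((1+ω)/2) + 2κ_w‖B‖_op‖Δ‖_F + κ₁(‖Δ‖_F Z₁ + ‖B‖_F Z₂)` — the A-part of the level-two modulus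
  with `1 ↦ √((1+ω)/2)`; the bound on `ω` is `OneLinkOmega.abs_integral_reTrQuad_DD_le`.

References: cell note `HOME/p2/ONE-LINK-HIERARCHY.md` §4 (4.4)–(4.5).
-/

noncomputable section

open scoped Matrix ComplexConjugate BigOperators ContDiff Matrix.Norms.Frobenius
open Matrix Complex Finset MeasureTheory ProbabilityTheory
open Literature.MathematicalPhysics.QuantumFieldTheory
open Literature.MathematicalPhysics.QuantumFieldTheory.SUNBakryEmery

namespace Summit.Ventures.YMGap.OneLinkEigen

variable {N : ℕ}

/-- **Minkowski for the `Γ`-seminorm in `L²(ν)`**: `√∫Γ(f+g,f+g) ≤ √∫Γ(f,f) + √∫Γ(g,g)` for smooth `f, g`. [folklore] -/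
theorem sqrt_integral_Gam_add_le {f g : Matrix (Fin N) (Fin N) ℂ → ℝ} (hf : ContDiff ℝ ∞ f) (hg : ContDiff ℝ ∞ g)
    (μ : Measure (SUN N)) [IsFiniteMeasure μ] :
    Real.sqrt (∫ x : SUN N, Gam (f + g) (f + g) x ∂μ) ≤
      Real.sqrt (∫ x : SUN N, Gam f f x ∂μ) + Real.sqrt (∫ x : SUN N, Gam g g x ∂μ) := by
  set A : ℝ := ∫ x : SUN N, Gam f f x ∂μ with hA
  set C : ℝ := ∫ x : SUN N, Gam g g x ∂μ with hC
  have hA0 : 0 ≤ A := integral_nonneg fun x => Gam_self_nonneg f _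
  have hC0 : 0 ≤ C := integral_nonneg fun x => Gam_self_nonneg g _
  have hexp : ∀ x : SUN N, Gam (f + g) (f + g) x = Gam f f x + 2 * Gam f g x + Gam g g x := by
    intro x
    rw [Gam_add_right _ hf hg, Gam_comm (f + g) f, Gam_comm (f + g) g, Gam_add_right _ hf hg, Gam_add_right _ hf hg,
      Gam_comm g f]
    ring
  have hsf : Continuous fun x : SUN N => Real.sqrt (Gam f f x) := Real.continuous_sqrt.comp (continuous_restrict (contDiff_Gam hf hf))
  have hsg : Continuous fun x : SUN N => Real.sqrt (Gam g g x) := Real.continuous_sqrt.comp (continuous_restrict (contDiff_Gam hg hg))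
  have hcs := abs_integral_mul_le_sqrt hsf hsg μ
  have e1 : (fun x : SUN N => Real.sqrt (Gam f f x) ^ 2) = fun x : SUN N => Gam f f (x : Matrix (Fin N) (Fin N) ℂ) := by
    funext x; exact Real.sq_sqrt (Gam_self_nonneg f _)
  have e2 : (fun x : SUN N => Real.sqrt (Gam g g x) ^ 2) = fun x : SUN N => Gam g g (x : Matrix (Fin N) (Fin N) ℂ) := by
    funext x; exact Real.sq_sqrt (Gam_self_nonneg g _)
  rw [e1, e2] at hcs
  have iff' : Integrable (fun x : SUN N => Gam f f x) μ := integrable_of_continuous_SUN (continuous_restrict (contDiff_Gam hf hf)) μ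
  have igg : Integrable (fun x : SUN N => Gam g g x) μ := integrable_of_continuous_SUN (continuous_restrict (contDiff_Gam hg hg)) μ
  have ifg : Integrable (fun x : SUN N => Gam f g x) μ := integrable_of_continuous_SUN (continuous_restrict (contDiff_Gam hf hg)) μ
  have hmid : ∫ x : SUN N, Gam f g x ∂μ ≤ Real.sqrt A * Real.sqrt C := by
    have hpt : ∀ x : SUN N, Gam f g x ≤ Real.sqrt (Gam f f x) * Real.sqrt (Gam g g x) := fun x =>
      (le_abs_self _).trans (abs_Gam_le f g _)
    calc ∫ x : SUN N, Gam f g x ∂μ ≤ ∫ x : SUN N, Real.sqrt (Gam f f x) * Real.sqrt (Gam g g x) ∂μ :=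
          integral_mono ifg (integrable_of_continuous_SUN (hsf.mul hsg) μ) hpt
      _ ≤ _ := (le_abs_self _).trans hcs
  have hle : ∫ x : SUN N, Gam (f + g) (f + g) x ∂μ ≤ (Real.sqrt A + Real.sqrt C) ^ 2 := by
    simp_rw [hexp]
    have i12 : Integrable (fun x : SUN N => Gam f f x + 2 * Gam f g x) μ := iff'.add (ifg.const_mul 2)
    rw [integral_add i12 igg, integral_add iff' (ifg.const_mul 2), integral_const_mul, add_sq,
      Real.sq_sqrt hA0, Real.sq_sqrt hC0]
    linarith
  calc Real.sqrt (∫ x : SUN N, Gam (f + g) (f + g) x ∂μ) ≤ Real.sqrt ((Real.sqrt A + Real.sqrt C) ^ 2) := Real.sqrt_le_sqrt hle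
    _ = Real.sqrt A + Real.sqrt C := Real.sqrt_sq (add_nonneg (Real.sqrt_nonneg _) (Real.sqrt_nonneg _))

/-- **`∫ Γ(u,u) dν_B ≤ ½‖Δ‖_F² + ½|E Re tr(gΔgΔ)|`** for `u = Re tr(·Δ)` (the `Im tr(gΔ)²/N` term is dropped). [folklore] -/
theorem integral_Gam_pot_one_le (hN : N ≠ 0) (B Δ : Matrix (Fin N) (Fin N) ℂ) :
    ∫ g, Gam (pot 1 Δ) (pot 1 Δ) g ∂(haarProbability (SUN N)).tilted (fun g => (N : ℝ) * ((g : Matrix (Fin N) (Fin N) ℂ) * B).trace.re) ≤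
      1 / 2 * frobNorm Δ ^ 2 + 1 / 2 * |∫ g, ((g : Matrix (Fin N) (Fin N) ℂ) * Δ * g * Δ).trace.re
        ∂(haarProbability (SUN N)).tilted (fun g => (N : ℝ) * ((g : Matrix (Fin N) (Fin N) ℂ) * B).trace.re)| := by
  have hNpos : (0 : ℝ) < N := Nat.cast_pos.2 (Nat.pos_of_ne_zero hN)
  set ν : Measure (SUN N) :=
    (haarProbability (SUN N)).tilted (fun g => (N : ℝ) * ((g : Matrix (Fin N) (Fin N) ℂ) * B).trace.re) with hν
  have hexpi : Integrable (fun g : SUN N => Real.exp ((N : ℝ) * ((g : Matrix (Fin N) (Fin N) ℂ) * B).trace.re))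
      (haarProbability (SUN N)) :=
    integrable_of_continuous_SUN (Real.continuous_exp.comp (continuous_restrict (contDiff_pot (N : ℝ) B))) _
  haveI : IsProbabilityMeasure ν := isProbabilityMeasure_tilted hexpi
  have hpt : ∀ g : SUN N, Gam (pot 1 Δ) (pot 1 Δ) g =
      -(1 / 2) * ((g : Matrix (Fin N) (Fin N) ℂ) * Δ * g * Δ).trace.re + 1 / 2 * frobNorm Δ ^ 2
        - 1 / N * ((Δ * (g : Matrix (Fin N) (Fin N) ℂ)).trace.im) ^ 2 := by
    intro g
    rw [Gam_pot_pot_su hN, trace_BgMg Δ Δ (g : Matrix (Fin N) (Fin N) ℂ)]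
    have hF : (Δ * Δᴴ).trace.re = frobNorm Δ ^ 2 := by rw [frobNorm_sq_eq_re_trace, trace_mul_comm]
    rw [hF]; ring
  have hwc : Continuous fun g : SUN N => ((g : Matrix (Fin N) (Fin N) ℂ) * Δ * g * Δ).trace.re :=
    continuous_restrict (contDiff_reTrQuad Δ Δ)
  have hYc : Continuous fun g : SUN N => ((Δ * (g : Matrix (Fin N) (Fin N) ℂ)).trace.im) ^ 2 :=
    (Complex.continuous_im.comp ((continuous_const.matrix_mul continuous_subtype_val).matrix_trace)).pow 2
  have iw : Integrable (fun g : SUN N => ((g : Matrix (Fin N) (Fin N) ℂ) * Δ * g * Δ).trace.re) ν := integrable_of_continuous_SUN hwc ν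
  have iY : Integrable (fun g : SUN N => ((Δ * (g : Matrix (Fin N) (Fin N) ℂ)).trace.im) ^ 2) ν := integrable_of_continuous_SUN hYc ν
  simp_rw [hpt]
  have i12 : Integrable (fun g : SUN N => -(1 / 2) * ((g : Matrix (Fin N) (Fin N) ℂ) * Δ * g * Δ).trace.re + 1 / 2 * frobNorm Δ ^ 2) ν :=
    (iw.const_mul _).add (integrable_const _)
  rw [integral_sub i12 (iY.const_mul _), integral_add (iw.const_mul _) (integrable_const _)]
  have hc : ∫ _ : SUN N, (1 / 2 * frobNorm Δ ^ 2 : ℝ) ∂ν = 1 / 2 * frobNorm Δ ^ 2 := by simp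
  rw [hc, integral_const_mul, integral_const_mul]
  have hY0 : 0 ≤ 1 / (N : ℝ) * ∫ g, ((Δ * (g : Matrix (Fin N) (Fin N) ℂ)).trace.im) ^ 2 ∂ν :=
    mul_nonneg (by positivity) (integral_nonneg fun g => sq_nonneg _)
  have habs := neg_abs_le (∫ g, ((g : Matrix (Fin N) (Fin N) ℂ) * Δ * g * Δ).trace.re ∂ν)
  linarith

/-- **The `L²(ν_B)` gradient norm of `u + ψ₂` through `ω`**: if `|E Re tr(gΔgΔ)| ≤ ω‖Δ‖_F²` (`ω = om`) then
`√(∫ Γ(u+ψ₂, u+ψ₂) dν_B) ≤ ‖Δ‖_F √((1+ω)/2) + 2κ_w‖B‖_op‖Δ‖_F + κ₁(‖Δ‖_F Z₁ + ‖B‖_F Z₂)`. [folklore] -/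
theorem sqrt_integral_Gam_upsi_le_omega (hN : 3 ≤ N) (B Δ : Matrix (Fin N) (Fin N) ℂ) {om : ℝ}
    (hom : |∫ g, ((g : Matrix (Fin N) (Fin N) ℂ) * Δ * g * Δ).trace.re
        ∂(haarProbability (SUN N)).tilted (fun g => (N : ℝ) * ((g : Matrix (Fin N) (Fin N) ℂ) * B).trace.re)| ≤ om * frobNorm Δ ^ 2) :
    Real.sqrt (∫ g, Gam (pot 1 Δ + fun Q : Matrix (Fin N) (Fin N) ℂ =>
          -((N : ℝ) ^ 2 / (4 * ((N : ℝ) ^ 2 - 4))) * (Q * Δ * Q * B).trace.re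
            + ((N : ℝ) / (2 * ((N : ℝ) ^ 2 - 4))) * ((Q * B).trace * (Q * Δ).trace).re
            - (1 / (4 * (N : ℝ))) * ((Q * B).trace * (starRingEnd ℂ) (Q * Δ).trace).re)
        (pot 1 Δ + fun Q : Matrix (Fin N) (Fin N) ℂ =>
          -((N : ℝ) ^ 2 / (4 * ((N : ℝ) ^ 2 - 4))) * (Q * Δ * Q * B).trace.re
            + ((N : ℝ) / (2 * ((N : ℝ) ^ 2 - 4))) * ((Q * B).trace * (Q * Δ).trace).re
            - (1 / (4 * (N : ℝ))) * ((Q * B).trace * (starRingEnd ℂ) (Q * Δ).trace).re) g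
        ∂(haarProbability (SUN N)).tilted (fun g => (N : ℝ) * ((g : Matrix (Fin N) (Fin N) ℂ) * B).trace.re)) ≤
      (frobNorm Δ * Real.sqrt ((1 + om) / 2) + (N : ℝ) ^ 2 / (4 * ((N : ℝ) ^ 2 - 4)) * (2 * matrixOpNorm B * frobNorm Δ))
        + ((N : ℝ) / (2 * ((N : ℝ) ^ 2 - 4)) + 1 / (4 * (N : ℝ))) * frobNorm Δ *
          Real.sqrt (∫ g, ‖((g : Matrix (Fin N) (Fin N) ℂ) * B).trace‖ ^ 2
            ∂(haarProbability (SUN N)).tilted (fun g => (N : ℝ) * ((g : Matrix (Fin N) (Fin N) ℂ) * B).trace.re))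
        + ((N : ℝ) / (2 * ((N : ℝ) ^ 2 - 4)) + 1 / (4 * (N : ℝ))) * frobNorm B *
          Real.sqrt (∫ g, ‖((g : Matrix (Fin N) (Fin N) ℂ) * Δ).trace‖ ^ 2
            ∂(haarProbability (SUN N)).tilted (fun g => (N : ℝ) * ((g : Matrix (Fin N) (Fin N) ℂ) * B).trace.re)) := by
  have hN0 : N ≠ 0 := by omega
  have hNpos : (0 : ℝ) < N := Nat.cast_pos.2 (Nat.pos_of_ne_zero hN0)
  have hD0 := frobNorm_nonneg Δ
  set ν : Measure (SUN N) :=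
    (haarProbability (SUN N)).tilted (fun g => (N : ℝ) * ((g : Matrix (Fin N) (Fin N) ℂ) * B).trace.re) with hν
  have hexpi : Integrable (fun g : SUN N => Real.exp ((N : ℝ) * ((g : Matrix (Fin N) (Fin N) ℂ) * B).trace.re))
      (haarProbability (SUN N)) :=
    integrable_of_continuous_SUN (Real.continuous_exp.comp (continuous_restrict (contDiff_pot (N : ℝ) B))) _
  haveI : IsProbabilityMeasure ν := isProbabilityMeasure_tilted hexpi
  have hψ := contDiff_psiTwo N B Δ
  have hu : ContDiff ℝ ∞ (pot (N := N) 1 Δ) := contDiff_pot 1 Δ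
  have hmink := sqrt_integral_Gam_add_le hu hψ ν
  have hu_le : Real.sqrt (∫ g, Gam (pot 1 Δ) (pot 1 Δ) g ∂ν) ≤ frobNorm Δ * Real.sqrt ((1 + om) / 2) := by
    have h1 := integral_Gam_pot_one_le hN0 B Δ (N := N)
    rw [← hν] at h1
    have h2 : ∫ g, Gam (pot 1 Δ) (pot 1 Δ) g ∂ν ≤ frobNorm Δ ^ 2 * ((1 + om) / 2) := by nlinarith [h1, hom]
    calc Real.sqrt (∫ g, Gam (pot 1 Δ) (pot 1 Δ) g ∂ν) ≤ Real.sqrt (frobNorm Δ ^ 2 * ((1 + om) / 2)) := Real.sqrt_le_sqrt h2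
      _ = frobNorm Δ * Real.sqrt ((1 + om) / 2) := by rw [Real.sqrt_mul (sq_nonneg _), Real.sqrt_sq hD0]
  have hψ_le := sqrt_integral_Gam_psiTwo_le hN B Δ
  rw [← hν] at hψ_le
  linarith [hmink, hu_le, hψ_le]

end Summit.Ventures.YMGap.OneLinkEigen
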